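import Summits.HodgeConjecture.HodgeConjecture.Theorems.UeP4N3corePairReading
import Summits.HodgeConjecture.HodgeConjecture.Theorems.UeP4UnivFamilyLDeltaClassPiece
import Literature.AlgebraicGeometry.HodgeTheory.MotivatedClassesDeformation
import HarnessLib

/-!
# U-e (N3-core) assembler ON A SMOOTH CLOPEN PIECE: one global class reads the polarisation Gram at both points of a pair

Sub-problem `HodgeConjecture` (cell HC_CM, (U)-lane node U-e P4, G-AN1 «P4 local on the base / P4 on a smooth clopen piece»;
P4 lead / assembler B-p03 (g14)).  PIECE EDITION of ★ `UnivFamilyPairReading.ue_N3asm_pairReading_holds`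
(`Theorems/UeP4N3corePairReading.lean`): the base `M ⊗ ℂ` of the complexified universal family of the Siegel fine moduli scheme
is replaced by a smooth quasi-projective piece `ι : S′ ⟶ M ⊗ ℂ` (an open immersion, `S′` smooth of relative dimension `d`), the
family by its pullback `f′ := familyPullback.snd (univFamilyℂ 𝓜) ι : 𝒳′ ⟶ S′`, fibre triples are classified at `ι(x)`, and the
pinned identification `e x : A_x(ℂ) ≃ X′_x(ℂ)` is extended by ★ `Motives.fiberOverFamilyPullbackIso`.  Conclusion: for a PAIR
`x₀, x ∈ W ⊆ S′(ℂ)` with Appell–Humbert data `p₀, p` there is ONE class `C ∈ H²(𝒳′(ℂ); ℂ)` and ONE scalar `c ≠ 0` with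
`C|_{X′_y} = c • Σ_a Σ_b E_y(λ_a, λ_b) (γ_y a ⊗ 1) ⌣ (γ_y b ⊗ 1)` at `y = x₀` and at `y = x`.  ROAD = the global road verbatim
([MumfordFogartyKirwan1994] Ch. 6 §2 Prop. 6.10; [VoisinHodgeII2003] §3.1.2; [LangeBirkenhake1992] Ch. 2 Thm. 2.1.2, Ch. 4
Thm. 4.5.1): `C` is the topological ℂ-Euler class of a cocycle of `(L^Δ(λ^univ))^{-q}` pulled back to `𝒳′`; its fibre reading
is ★ `UnivFamilyLDeltaClass.coreEulerClass_fibre_reading_piece'` ((A1-piece), B-p16 (g12)); every per-fibre step (ample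
translate of `2Θ_y`, common `(q, K)`, `ℙᴷ` Hodge model, rigidity scalar, ★ (F-fib)) is byte-identical with the global edition and
the bookkeeping is ★ `UnivFamilyPairReading.reading_algebra`.  The total space `𝒳′` is smooth of relative dimension `g + d` over
`ℂ`, separated and quasi-compact (from `S′`), whence `𝒳′(ℂ)` is Hausdorff and paracompact.  Main result:
`ue_N3asm_pairReading_piece_holds` (the lead's socket text `UHead.Ue_N3asm_pairReading_piece`, `IsFlatIntegralFrame` spelled
out).  HC_CM is proved only modulo the 7 printed citations until rung 0 closes; this helper changes no count.

## References
* [MumfordFogartyKirwan1994] D. Mumford, J. Fogarty, F. Kirwan, *Geometric Invariant Theory*, 3rd ed., Ch. 6 §2 Prop. 6.10 (p. 121),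
  Ch. 7 §2 Def. 7.2 (p. 129), §3 Thm. 7.9 (p. 139).
* [VoisinHodgeII2003] C. Voisin, *Hodge Theory and Complex Algebraic Geometry II*, CUP 2003, §3.1.2.
* [LangeBirkenhake1992] H. Lange, Ch. Birkenhake, *Complex Abelian Varieties*, Springer 1992, Ch. 2 §2.1 Thm. 2.1.2, Ch. 4 Thm. 4.5.1,
  Ch. 8 §8.1.
* [Hartshorne1977] R. Hartshorne, *Algebraic Geometry*, Springer 1977, II Thm. 7.6, III Ex. 4.5, III Prop. 9.3.
* [MilnorStasheff1974] J. Milnor, J. Stasheff, *Characteristic Classes*, Princeton 1974, §14 Thm. 14.4.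
-/

set_option autoImplicit false
set_option linter.dupNamespace false

noncomputable section

open CategoryTheory CategoryTheory.Limits AlgebraicGeometry Matrix Topology
open Literature.AlgebraicGeometry
open Literature.AlgebraicGeometry.Motives (SchemeOver ComplexPoints AlgPoints specOver AbelianVariety CartierDivisor fiberOver)
open Literature.AlgebraicGeometry.Motives
open Literature.AlgebraicGeometry.Modules
open Literature.AlgebraicGeometry.HodgeTheory
open Literature.AlgebraicGeometry.AbelianSchemes (PolarizedAbelianSchemeWithLevel AbelianSchemeOver)
open Literature.AlgebraicGeometry.ModuliOfAbelianVarieties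
open Literature.AlgebraicGeometry.ModuliOfAbelianVarieties.SiegelModuli
open Literature.AlgebraicGeometry.ModuliOfAbelianVarieties.W1
open Literature.Geometry.Kaehler (ComplexTorus)
open Literature.NumberTheory.Transcendental (IsAnalytification)
open Literature.NumberTheory.Automorphic (siegelUpperHalfSpace)
open Literature.NumberTheory.Adeles
open Literature.AlgebraicTopology.SingularHomology
open Literature.AlgebraicTopology.CharacteristicClasses

namespace Summit.HodgeConjecture.HodgeConjecture.Theorems

namespace UnivFamilyPairReadingPiece

/-! ### The socket (R-piece), proved -/

/-- **ASSEMBLER SOCKET (R-piece) DISCHARGED — `ue_N3asm_pairReading_piece_holds`** (the lead's `UHead.Ue_N3asm_pairReading_piece`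
with `IsFlatIntegralFrame` spelled out): the global edition ★ `UnivFamilyPairReading.ue_N3asm_pairReading_holds` re-threaded along
a smooth clopen piece `ι : S′ ⟶ M ⊗ ℂ`. [cite: MumfordFogartyKirwan1994, Ch. 6 §2 Prop. 6.10 (p. 121)] [cite: VoisinHodgeII2003, §3.1.2]
[cite: LangeBirkenhake1992, Ch. 8 §8.1] [cite: Hartshorne1977, Ch. III Prop. 9.3] -/
theorem ue_N3asm_pairReading_piece_holds :
    ∀ (g N : ℕ) (δ : Fin g → ℕ) (_hg : 0 < g) (_hδ : IsPolarizationType δ) (_hN : 3 ≤ N)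
      (𝓜 : SiegelFineModuliScheme g N δ) (_hMq : HodgeTheory.IsQuasiProjectiveOver 𝓜.M)
      (_hXq : HodgeTheory.IsQuasiProjectiveOver (W1.univTotal 𝓜))
      {S' : SchemeOver ℂ} (ι : S' ⟶ (Motives.baseChange ℚ ℂ).obj 𝓜.M) [IsOpenImmersion ι.left]
      (_hSq : HodgeTheory.IsQuasiProjectiveOver S') (d : ℕ) [SmoothOfRelativeDimension d S'.hom],
      haveI : IsLocallyNoetherian (specOver ℚ ℂ).left :=
        inferInstanceAs (IsLocallyNoetherian (Spec (CommRingCat.of ℂ)))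
      ∀ (W : Set (ComplexPoints S')) (_hW : IsPathConnected W)
        (hU : HodgeTheory.IsCohomologicallyLocallyTrivialOn (Motives.familyPullback.snd (W1.univFamilyℂ 𝓜) ι) W)
        (P' : W → PolarizedAbelianSchemeWithLevel g N δ (specOver ℚ ℂ).left)
        (G : ∀ x : W, (P' x).A.X.left ⟶ 𝓜.univ.A.X.left) (Ĝ : ∀ x : W, (P' x).D.hat.X.left ⟶ 𝓜.univ.D.hat.X.left)
        (hbc : ∀ x : W, (P' x).IsBaseChangeVia 𝓜.univ
          ((AlgPoints.baseChangeEquiv (algebraMap ℚ ℂ) 𝓜.M).symm (AlgPoints.map (L := ℂ) ι x.1)).left (G x) (Ĝ x))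
        (γ : ∀ x : W, Fin g ⊕ Fin g →
          singularCohomology ℚ ℚ (ComplexPoints (fiberOver (Motives.familyPullback.snd (W1.univFamilyℂ 𝓜) ι) x.1)) 1)
        (Φ : ∀ _x : W, (Fin g ⊕ Fin g → ℝ) ≃L[ℝ] (Fin g → ℂ))
        (φ : ∀ x : W, C(ComplexTorus (Φ x), ((P' x).A.fibre (𝟙 (Spec (CommRingCat.of ℂ)))).toAbelianVariety.Points ℂ))
        (hφ : ∀ x : W, IsAnalytification (Fin g → ℂ)
          ((P' x).A.fibre (𝟙 (Spec (CommRingCat.of ℂ)))).toAbelianVariety.X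
          ((P' x).A.fibre (𝟙 (Spec (CommRingCat.of ℂ)))).toAbelianVariety.dim (φ x))
        (Θ : ∀ x : W, CartierDivisor ((P' x).A.fibre (𝟙 (Spec (CommRingCat.of ℂ)))).toAbelianVariety.X.left),
        ((∀ x : W, LinearIndependent ℂ fun a => HodgeTheory.ofRatClass _ 1 (γ x a)) ∧
          (∀ (x : W) (c : HodgeTheory.complexBetti (fiberOver (Motives.familyPullback.snd (W1.univFamilyℂ 𝓜) ι) x.1) 1),
              HodgeTheory.IsIntegralClass c ↔
                c ∈ Submodule.span ℤ (Set.range fun a => HodgeTheory.ofRatClass _ 1 (γ x a))) ∧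
          ∀ (x x' : W) (p : Path.Homotopic.Quotient x x') (a : Fin g ⊕ Fin g),
            HodgeTheory.transportFun (Motives.familyPullback.snd (W1.univFamilyℂ 𝓜) ι) 1 hU p (HodgeTheory.ofRatClass _ 1 (γ x a)) =
              HodgeTheory.ofRatClass _ 1 (γ x' a)) →
        (∀ (x : W) (s t : ComplexTorus (Φ x)), φ x (s + t) = φ x s * φ x t) →
        (∀ (x : W) (a : Fin g ⊕ Fin g),
          singularCohomology.map ℚ ℚ
              (((Motives.AlgPoints.homeomorphOfIso (L := ℂ)
                  (W1.fibreAVIso (P' x) ≪≫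
                    (W1.fiberUnivIsoOfIsBaseChangeVia 𝓜 (AlgPoints.map (L := ℂ) ι x.1) (P' x) (G x) (Ĝ x) (hbc x)).symm ≪≫
                    (Motives.fiberOverFamilyPullbackIso (W1.univFamilyℂ 𝓜) ι x.1).symm) :
                  ((P' x).A.fibre (𝟙 (Spec (CommRingCat.of ℂ)))).toAbelianVariety.Points ℂ ≃ₜ
                    ComplexPoints (fiberOver (Motives.familyPullback.snd (W1.univFamilyℂ 𝓜) ι) x.1)) :
                C(((P' x).A.fibre (𝟙 (Spec (CommRingCat.of ℂ)))).toAbelianVariety.Points ℂ,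
                  ComplexPoints (fiberOver (Motives.familyPullback.snd (W1.univFamilyℂ 𝓜) ι) x.1))).comp (φ x)) 1 (γ x a) =
            HodgeTheory.latticeClass (Φ x) a) →
        (∀ x : W, (Θ x).IsAmple) →
        (∀ x : W, (P' x).A.IsLambdaOfAt (𝟙 (Spec (CommRingCat.of ℂ))) (P' x).D (P' x).pol.lam (Θ x)) →
        ∀ (x₀ x : W) (p₀ : ComplexTorus.AHData (Φ x₀)) (p : ComplexTorus.AHData (Φ x)),
          ComplexTorus.AHData.toPic p₀ =
              ComplexTorus.picClass (HodgeTheory.cartierDivisorLineBundle (hφ x₀) (Θ x₀)) →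
          ComplexTorus.AHData.toPic p =
              ComplexTorus.picClass (HodgeTheory.cartierDivisorLineBundle (hφ x) (Θ x)) →
          ∃ (C : HodgeTheory.complexBetti (Motives.familyPullback (W1.univFamilyℂ 𝓜) ι) 2) (c : ℂ), c ≠ 0 ∧
            HodgeTheory.complexBetti.map (Motives.fiberι (Motives.familyPullback.snd (W1.univFamilyℂ 𝓜) ι) x₀.1) 2 C =
              c • ∑ a, ∑ b, ((ComplexTorus.intGram (Φ x₀) p₀.form a b : ℤ) : ℂ) •
                cupProduct (show 1 + 1 = 2 from rfl) (HodgeTheory.ofRatClass _ 1 (γ x₀ a)) (HodgeTheory.ofRatClass _ 1 (γ x₀ b)) ∧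
            HodgeTheory.complexBetti.map (Motives.fiberι (Motives.familyPullback.snd (W1.univFamilyℂ 𝓜) ι) x.1) 2 C =
              c • ∑ a, ∑ b, ((ComplexTorus.intGram (Φ x) p.form a b : ℤ) : ℂ) •
                cupProduct (show 1 + 1 = 2 from rfl) (HodgeTheory.ofRatClass _ 1 (γ x a)) (HodgeTheory.ofRatClass _ 1 (γ x b)) := by
  intro g N δ hg hδ hN 𝓜 hMq hXq S' ι _ hSq d _ W hW hU P' G Ĝ hbc γ Φ φ hφ Θ hflat hadd hframe hΘ hlam x₀ x p₀ p hp₀ hp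
  classical
  have hN0 : N ≠ 0 := by omega
  /- ### instances: base, total space, fibres, `ℙᴷ` -/
  have hf := UnivFamilyHodgeFrames.isSmoothProjectiveFamily_univFamilyℂ_of_classify 𝓜
  have hf' : Motives.IsSmoothProjectiveFamily (Motives.familyPullback.snd (W1.univFamilyℂ 𝓜) ι) g :=
    Motives.IsSmoothProjectiveFamily.familyPullback_snd ι hf
  haveI : SmoothOfRelativeDimension g (Motives.familyPullback.snd (W1.univFamilyℂ 𝓜) ι).left := hf'.smoothOfRelativeDimension
  haveI : IsProper (Motives.familyPullback.snd (W1.univFamilyℂ 𝓜) ι).left := hf'.isProper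
  haveI : LocallyOfFiniteType S'.hom := hSq.isVarietyPair_ofScheme.locallyOfFiniteType
  haveI : IsSeparated S'.hom := hSq.isVarietyPair_ofScheme.isSeparated
  haveI : QuasiCompact S'.hom := hSq.isVarietyPair_ofScheme.quasiCompact
  have hXhom : (Motives.familyPullback (W1.univFamilyℂ 𝓜) ι).hom =
      (Motives.familyPullback.snd (W1.univFamilyℂ 𝓜) ι).left ≫ S'.hom :=
    (Over.w (Motives.familyPullback.snd (W1.univFamilyℂ 𝓜) ι)).symm
  haveI : LocallyOfFiniteType (Motives.familyPullback (W1.univFamilyℂ 𝓜) ι).hom := by rw [hXhom]; infer_instance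
  haveI : IsSeparated (Motives.familyPullback (W1.univFamilyℂ 𝓜) ι).hom := by rw [hXhom]; infer_instance
  haveI : QuasiCompact (Motives.familyPullback (W1.univFamilyℂ 𝓜) ι).hom := by rw [hXhom]; infer_instance
  haveI : SmoothOfRelativeDimension (g + d) (Motives.familyPullback (W1.univFamilyℂ 𝓜) ι).hom := by
    rw [hXhom]; infer_instance
  haveI : CompactSpace (Motives.familyPullback (W1.univFamilyℂ 𝓜) ι).left :=
    QuasiCompact.compactSpace_of_compactSpace (Motives.familyPullback (W1.univFamilyℂ 𝓜) ι).hom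
  haveI : SecondCountableTopology (ComplexPoints (Motives.familyPullback (W1.univFamilyℂ 𝓜) ι)) :=
    ComplexPoints.secondCountableTopology_of_compactSpace_holds _
  haveI : T2Space (ComplexPoints (Motives.familyPullback (W1.univFamilyℂ 𝓜) ι)) :=
    ComplexPoints.t2Space_of_isSeparated _
  haveI : ParacompactSpace (ComplexPoints (Motives.familyPullback (W1.univFamilyℂ 𝓜) ι)) :=
    ComplexPoints.paracompactSpace_of_smooth _ (g + d)
  haveI hP2 : T2Space (ComplexPoints (projectiveSpace 0 ℂ)) :=
    ComplexPoints.t2Space_of_isSmoothProjective (isSmoothProjective_projectiveSpace' 0)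
  /- ### the universal `L^Δ(λ)` and its (inverse) class -/
  set Gr : 𝓜.univ.A.X.left ⟶ 𝓜.univ.A.prodLeft 𝓜.univ.D.hat :=
    pullback.lift (𝟙 _) 𝓜.univ.pol.lam.left (by rw [Category.id_comp]; exact (Over.w 𝓜.univ.pol.lam).symm) with hGr
  have hGr₁ : Gr ≫ pullback.fst _ _ = 𝟙 _ := pullback.lift_fst _ _ _
  have hGr₂ : Gr ≫ pullback.snd _ _ = 𝓜.univ.pol.lam.left := pullback.lift_snd _ _ _
  have hL𝓛 : IsFiniteLocallyFree ((Scheme.Modules.pullback Gr).obj 𝓜.univ.D.P) :=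
    (HasRank.isFiniteLocallyFree' 𝓜.univ.D.hasRank_one).pullback Gr
  set L : CechPic 𝓜.univ.A.X.left := (detClass hL𝓛)⁻¹ with hL
  /- ### per fibre: the class `c_y := (j ≫ G y)^*[L^Δ(λ)]` has `φ_{c_y} = φ_{Θ y}²`, hence is an ample translate of `2 Θ y` -/
  have hdim : ∀ y : W, ((P' y).A.fibre (𝟙 (Spec (CommRingCat.of ℂ)))).toAbelianVariety.dim = g := fun y ↦
    AbelianVariety.dim_eq_of_isAnalytification_pi (hφ y)
  have hphi : ∀ (y : W) (z : ((P' y).A.fibre (𝟙 (Spec (CommRingCat.of ℂ)))).toAbelianVariety.Points ℂ),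
      AbelianVarieties.phiPic _ (CechPic.pullback (pullback.fst (P' y).A.X.hom (𝟙 (Spec (CommRingCat.of ℂ))) ≫ G y) (detClass hL𝓛)) z =
        AbelianVarieties.phiPic _ (Θ y).cechClass z ^ 2 := by
    intro y z
    obtain ⟨-, -, ⟨wG, wĜ, ⟨e⟩⟩, hlamG⟩ := hbc y
    exact 𝓜.univ.A.phiPic_pullback_detClass_LDelta_of_isBaseChangeVia 𝓜.univ.D 𝓜.univ.pol.lam (P' y).A (P' y).D
      (P' y).pol.lam _ (G y) (Ĝ y) wG wĜ Gr hGr₁ hGr₂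
      (pullback.lift (𝟙 _) (P' y).pol.lam.left (by rw [Category.id_comp]; exact (Over.w (P' y).pol.lam).symm))
      (pullback.lift_fst _ _ _) (pullback.lift_snd _ _ _) (𝟙 (Spec (CommRingCat.of ℂ))) hlamG e hL𝓛 rfl (hlam y) z
  have htr : ∀ y : W, ∃ Dy : CartierDivisor ((P' y).A.fibre (𝟙 (Spec (CommRingCat.of ℂ)))).toAbelianVariety.X.left,
      CechPic.pullback (pullback.fst (P' y).A.X.hom (𝟙 (Spec (CommRingCat.of ℂ))) ≫ G y) (detClass hL𝓛) = Dy.cechClass ∧ Dy.IsAmple := by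
    intro y
    obtain ⟨t, ht, hamp⟩ := AbelianVariety.exists_eq_cechClass_pullback_translation_two_smul_of_phiPic_eq_sq
      ((P' y).A.fibre (𝟙 (Spec (CommRingCat.of ℂ)))).toAbelianVariety (hΘ y) _ (hphi y)
    exact ⟨_, ht, hamp⟩
  obtain ⟨D₀, hD₀, hD₀amp⟩ := htr x₀
  obtain ⟨D₁, hD₁, hD₁amp⟩ := htr x
  /- ### one `(q, K)` for the pair, closed immersions, hyperplane divisors -/
  obtain ⟨q, hq, K, hK₀, ⟨ψ₀, hψ₀, a₀, ha₀, hlin₀⟩, ⟨ψ₁, hψ₁, a₁, ha₁, hlin₁⟩⟩ :=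
    CartierDivisor.IsAmple.exists_common_pos_smul_linEquiv_hyperplaneDivisor_le hD₀amp hD₁amp (max g 1)
  haveI := hψ₀
  haveI := hψ₁
  have hK1 : 1 ≤ K := le_trans (le_max_right g 1) hK₀
  have hgK : g ≤ K := le_trans (le_max_left g 1) hK₀
  /- ### the `ℙᴷ` Hodge model, its line constant `μ`, and ONE rigidity scalar `r` for all torus models of record -/
  haveI hPT2 : T2Space (ComplexPoints (projectiveSpace K ℂ)) :=
    ComplexPoints.t2Space_of_isSmoothProjective (isSmoothProjective_projectiveSpace' K)
  haveI : CompactSpace (ComplexPoints (projectiveSpace K ℂ)) :=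
    ComplexPoints.compactSpace_of_isSmoothProjective (isSmoothProjective_projectiveSpace' K)
  haveI hPpc : ParacompactSpace (ComplexPoints (projectiveSpace K ℂ)) := inferInstance
  obtain ⟨B⟩ : Nonempty (HodgeModel K (projectiveSpace K ℂ)) := nonempty_hodgeModel_holds (isSmoothProjective_projectiveSpace' K)
  have hj₁ : genericPoint (projectiveSpace K ℂ).left ∈ (GeneratingSections.affineChartData (𝟙 (projectiveSpace K ℂ))).U 0 :=
    ProjSpace.genericPoint_mem_U (d := K) (K := ℂ) 0
  obtain ⟨μ, hμ0, hμ⟩ := exists_ne_zero_coreEulerClass_eq_smul_chernCharacter_projectiveSpace B 0 hj₁ hK1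
  obtain ⟨r, hr0, hr⟩ := exists_ne_zero_forall_abelianVariety_torusModel_deRham_eq_smul_inducedIso
    (e₀ := (Literature.NumberTheory.Transcendental.integrationDeRhamIsoFamily (Fin g → ℂ)).complexify)
    integrationFamily_isNatural B hgK (2 * 1)
    ((P' x₀).A.fibre (𝟙 (Spec (CommRingCat.of ℂ)))).toAbelianVariety (Φ x₀) (φ x₀) (hφ x₀)
  /- ### the global class -/
  obtain ⟨cX, hcX⟩ : ∃ cX : UnitCocycle (Motives.familyPullback (W1.univFamilyℂ 𝓜) ι).left,
      CechPic.mk cX = CechPic.pullback ((Motives.familyPullback.fst (W1.univFamilyℂ 𝓜) ι).left ≫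
        baseChangeHomFst (algebraMap ℚ ℂ) (univTotal 𝓜)) L ^ q :=
    CechPic.mk_surjective _
  /- ### the fibre reading (once, for every `y`, given its translate, embedding and Appell–Humbert datum) -/
  have key : ∀ (y : W) (py : ComplexTorus.AHData (Φ y))
      (_hpy : ComplexTorus.AHData.toPic py =
        ComplexTorus.picClass (HodgeTheory.cartierDivisorLineBundle (hφ y) (Θ y)))
      (Dy : CartierDivisor ((P' y).A.fibre (𝟙 (Spec (CommRingCat.of ℂ)))).toAbelianVariety.X.left)
      (_hDy : CechPic.pullback (pullback.fst (P' y).A.X.hom (𝟙 (Spec (CommRingCat.of ℂ))) ≫ G y) (detClass hL𝓛) = Dy.cechClass)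
      (ψ : ((P' y).A.fibre (𝟙 (Spec (CommRingCat.of ℂ)))).toAbelianVariety.X ⟶ projectiveSpace K ℂ)
      (_ : IsClosedImmersion ψ.left) (a : Fin (K + 1))
      (ha : genericPoint ((P' y).A.fibre (𝟙 (Spec (CommRingCat.of ℂ)))).toAbelianVariety.X.left ∈
        (GeneratingSections.ofHom ψ.left).U a)
      (_hlin : (q • Dy).LinEquiv ((GeneratingSections.ofHom ψ.left).divisor a ha)),
      HodgeTheory.complexBetti.map (Motives.fiberι (Motives.familyPullback.snd (W1.univFamilyℂ 𝓜) ι) y.1) 2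
          (eulerClass ℂ cX.complexCore.Fiber (Module.finrank_self ℂ) ℂ 1) =
        (μ * r⁻¹ * q : ℂ) • ∑ a, ∑ b, ((ComplexTorus.intGram (Φ y) py.form a b : ℤ) : ℂ) •
          cupProduct (show 1 + 1 = 2 from rfl) (HodgeTheory.ofRatClass _ 1 (γ y a))
            (HodgeTheory.ofRatClass _ 1 (γ y b)) := by
    intro y py hpy Dy hDy ψ hψ a ha hlin
    haveI := hψ
    -- the fibre abelian variety and its instances
    have hSP : IsSmoothProjective ((P' y).A.fibre (𝟙 (Spec (CommRingCat.of ℂ)))).toAbelianVariety.dim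
        ((P' y).A.fibre (𝟙 (Spec (CommRingCat.of ℂ)))).toAbelianVariety.X := AbelianVariety.isSmoothProjective_holds
    haveI : T2Space (ComplexPoints (fibreAV (P' y)).X) := ComplexPoints.t2Space_of_isSmoothProjective hSP
    haveI : CompactSpace (ComplexPoints (fibreAV (P' y)).X) := ComplexPoints.compactSpace_of_isSmoothProjective hSP
    haveI : ParacompactSpace (ComplexPoints (fibreAV (P' y)).X) := inferInstance
    haveI : T2Space (ComplexPoints ((P' y).A.fibre (𝟙 (Spec (CommRingCat.of ℂ)))).toAbelianVariety.X) :=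
      ‹T2Space (ComplexPoints (fibreAV (P' y)).X)›
    haveI : ParacompactSpace (ComplexPoints ((P' y).A.fibre (𝟙 (Spec (CommRingCat.of ℂ)))).toAbelianVariety.X) :=
      ‹ParacompactSpace (ComplexPoints (fibreAV (P' y)).X)›
    have hAm : ((P' y).A.fibre (𝟙 (Spec (CommRingCat.of ℂ)))).toAbelianVariety.dim ≤ K := by rw [hdim y]; exact hgK
    -- the pinned homeomorphism `e y : A_y(ℂ) ≃ₜ X_y(ℂ)`
    let ey : ((P' y).A.fibre (𝟙 (Spec (CommRingCat.of ℂ)))).toAbelianVariety.Points ℂ ≃ₜ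
        ComplexPoints (fiberOver (Motives.familyPullback.snd (W1.univFamilyℂ 𝓜) ι) y.1) :=
      AlgPoints.homeomorphOfIso (L := ℂ)
        (fibreAVIso (P' y) ≪≫ (fiberUnivIsoOfIsBaseChangeVia 𝓜 (AlgPoints.map (L := ℂ) ι y.1) (P' y) (G y) (Ĝ y) (hbc y)).symm ≪≫
          (Motives.fiberOverFamilyPullbackIso (W1.univFamilyℂ 𝓜) ι y.1).symm)
    let eyC : C(((P' y).A.fibre (𝟙 (Spec (CommRingCat.of ℂ)))).toAbelianVariety.Points ℂ,
        ComplexPoints (fiberOver (Motives.familyPullback.snd (W1.univFamilyℂ 𝓜) ι) y.1)) := ey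
    -- the fibre cocycle and ★ (A1)
    obtain ⟨c', hc'⟩ : ∃ c' : UnitCocycle (fibreAV (P' y)).X.left,
        CechPic.mk c' = CechPic.pullback (pullback.fst (P' y).A.X.hom (𝟙 (Spec (CommRingCat.of ℂ))) ≫ G y) L ^ q :=
      CechPic.mk_surjective _
    have hA1 : singularCohomology.map ℂ ℂ eyC 2 (HodgeTheory.complexBetti.map (Motives.fiberι (Motives.familyPullback.snd (W1.univFamilyℂ 𝓜) ι) y.1) 2
        (eulerClass ℂ cX.complexCore.Fiber (Module.finrank_self ℂ) ℂ 1)) =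
        eulerClass ℂ c'.complexCore.Fiber (Module.finrank_self ℂ) ℂ 1 :=
      UnivFamilyLDeltaClass.coreEulerClass_fibre_reading_piece' 𝓜 ι y.1 (P' y) (G y) (Ĝ y) (hbc y) L q cX c' hcX hc'
    -- `[c′] = [𝒪(-D_ψ)]` (★ (F-alg) (ii)) and ★ (B) coboundary invariance
    have hmk : CechPic.mk c' = CechPic.mk (-(GeneratingSections.affineChartData ψ).divisor a ha).toUnitCocycle := by
      rw [hc', AbelianVariety.mk_neg_hyperplaneDivisor_toUnitCocycle_eq _ ψ hDy hlin, hL, map_inv, inv_pow]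
      rfl
    have hB := UnitCocycle.coreEulerClass_eq_of_mk_eq ℂ hmk (1 : ℂ)
    -- an Appell–Humbert datum of `𝒪(D_ψ)^an`
    obtain ⟨p', hp'⟩ := ComplexTorus.AHData.toPic_surjective
      (ComplexTorus.picClass (HodgeTheory.cartierDivisorLineBundle (hφ y) ((GeneratingSections.affineChartData ψ).divisor a ha)))
    -- the frame on `A_y(ℂ)`
    have hγA : ∀ b, singularCohomology.map ℚ ℚ (φ y) 1 (singularCohomology.map ℚ ℚ eyC 1 (γ y b)) =
        HodgeTheory.latticeClass (Φ y) b := by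
      intro b
      have h := hframe y b
      rw [singularCohomology.map_comp] at h
      exact h
    -- ★ (F-fib) and ★ (F-alg) (i)
    have hF := AbelianVariety.coreEulerClass_neg_hyperplaneDivisor_eq_smul_sum_intGram_cup
      ((P' y).A.fibre (𝟙 (Spec (CommRingCat.of ℂ)))).toAbelianVariety (Φ y) (φ y) (hφ y) B hAm hr0
      (hr _ (Φ y) (φ y) (hφ y) hAm) 0 hj₁ hμ ψ a ha p' hp'
      (fun b ↦ singularCohomology.map ℚ ℚ eyC 1 (γ y b)) hγA
    have hG := AbelianVariety.intGram_hyperplaneDivisor_eq_nsmul _ (hφ y) (hadd y) ψ (hphi y) hDy hlin py p' hpy hp'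
    -- combine and descend along `e y`
    have halg := UnivFamilyPairReading.reading_algebra eyC (γ y) (ComplexTorus.intGram (Φ y) py.form)
      (ComplexTorus.intGram (Φ y) p'.form) q hG μ r
    have hinj : Function.Injective (singularCohomology.map ℂ ℂ eyC 2) := fun u v huv ↦
      (singularCohomology.mapIso ℂ ℂ ey 2).toLinearEquiv.injective huv
    apply hinj
    rw [hA1, hB]
    exact hF.trans halg
  refine ⟨eulerClass ℂ cX.complexCore.Fiber (Module.finrank_self ℂ) ℂ 1, μ * r⁻¹ * q, ?_,
    key x₀ p₀ hp₀ D₀ hD₀ ψ₀ hψ₀ a₀ ha₀ hlin₀, key x p hp D₁ hD₁ ψ₁ hψ₁ a₁ ha₁ hlin₁⟩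
  exact mul_ne_zero (mul_ne_zero hμ0 (inv_ne_zero hr0)) (by exact_mod_cast hq.ne')

end UnivFamilyPairReadingPiece

end Summit.HodgeConjecture.HodgeConjecture.Theorems

end
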